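import Mathlib.LinearAlgebra.Matrix.Adjugate
import Mathlib.LinearAlgebra.Matrix.NonsingularInverse
import Mathlib.LinearAlgebra.Matrix.Block
import Mathlib.LinearAlgebra.Matrix.GeneralLinearGroup.Defs
import Mathlib.Algebra.Ring.GeomSum
import Mathlib.Data.Fin.Tuple.Basic
import Mathlib.Data.Fintype.Powerset
import Literature.Computability.AlgebraicComplexity.PermanentVsDeterminantProofs
import Literature.Computability.AlgebraicComplexity.EquivariantDC
import Literature.Computability.AlgebraicComplexity.DetReprEquivalent
import HarnessLib

/-!
# Grenet's determinantal representation of the permanent is equivariant for the two-sided torus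

Topic `Literature/Computability/AlgebraicComplexity`.  Companion of
`PermanentVsDeterminantProofs.lean` (Grenet's `dc(PER_n) ≤ 2ⁿ - 1`) and `EquivariantDC.lean`
(Landsberg–Ressayre's equivariant determinantal representations, `IsEquivariantDetRepr`).

## Content

* `Grenet.adj k n` — the weighted adjacency matrix of Grenet's branching program on the subsets of
  `Fin n` (arc `S → insert j S` of weight `X (j, |S|)`), now a named definition;
  `Grenet.repr k n e` — Grenet's `(2ⁿ - 1) × (2ⁿ - 1)` affine matrix (the `(univ, ∅)` minor of
  `1 - adj`, reindexed along `e : Finset (Fin n) ≃ Fin 2ⁿ`, times the sign `± 1`);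
  `Grenet.isAffineDetRepr_repr` — it is an affine determinantal representation of `PER_n`
  (the proof of `determinantalComplexity_perPoly_le_holds`, made reusable).
* `Grenet.isEquivariantDetRepr_repr` — **it respects the two-sided torus with EXACT lifts**: the
  substitution `X (p, q) ↦ d p * e q * X (p, q)` lifts to the diagonal vertex scalings
  `Λ(S) = ∏_{j ∈ S} d j * ∏_{c < |S|} e c` (an arc `S → insert j S` scales by `d j * e |S| =
  Λ(insert j S) / Λ(S)`, so `(1 - adj)(γ · x) = Λ⁻¹ (1 - adj) Λ`, and a minor of a diagonal conjugate
  is a diagonal conjugate of the minor); exact lifts compose (`IsEquivariantDetRepr.of_generators`).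
* `hasEquivariantDetRepr_perPoly_twoSidedTorus` — hence `per_n` (`n ≥ 1`) has a two-sided-torus-
  equivariant affine determinantal representation of size `2ⁿ - 1`: the UPPER-bound half of
  `edc_T(per_n) = 2ⁿ - 1` (Landsberg–Ressayre 2017, §2.2/Thm. 2.8), recorded in
  `LandsbergRessayre.lean` as not vendored.

## Sources

* B. Grenet, *An upper bound for the permanent versus determinant problem* (2011), Thm. 1.
* J. M. Landsberg, N. Ressayre, *Permanent v. determinant: an exponential lower bound assuming
  symmetry…*, Differential Geom. Appl. 55 (2017), §2.2, Thm. 2.8. [LandsbergRessayre2017]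
-/

noncomputable section
open MvPolynomial Matrix Finset
namespace Literature.Computability.AlgebraicComplexity
/-! ### Exact lifts compose: equivariance from generators -/
section Generators

variable {k : Type*} [CommRing k] {σ : Type*} [Fintype σ] [DecidableEq σ]
  {f : MvPolynomial σ k} {m : ℕ} {A : Matrix (Fin m) (Fin m) (MvPolynomial σ k)}

/-- **Equivariance from generators.**  If `A` is an affine determinantal representation of `f` and
every substitution in a set `S` lifts exactly to `GL_m × GL_m`, then `A` is equivariant for the
subgroup generated by `S`: exact lifts of `γ₁, γ₂` give exact lifts of `γ₁ γ₂` and of `γ₁⁻¹`.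
[cite: LandsbergRessayre2017, Def. 1.3] -/
theorem IsEquivariantDetRepr.of_generators {S : Set (GL σ k)} (hA : IsAffineDetRepr f A)
    (hS : ∀ γ ∈ S, ∃ g h : GL (Fin m) k,
      Matrix.linSubstEntries γ A =
        (g : Matrix (Fin m) (Fin m) k).map C * A * ((h⁻¹ : GL (Fin m) k) : Matrix (Fin m) (Fin m) k).map C) :
    IsEquivariantDetRepr (Subgroup.closure S) f A := by
  refine ⟨hA, fun γ hγ => ?_⟩
  induction hγ using Subgroup.closure_induction with
  | mem x hx => exact hS x hx
  | one =>
    refine ⟨1, 1, ?_⟩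
    simp [Matrix.map_one C C_0 C_1]
  | mul x y _ _ hx hy =>
    obtain ⟨g₁, h₁, h1⟩ := hx
    obtain ⟨g₂, h₂, h2⟩ := hy
    refine ⟨g₂ * g₁, h₂ * h₁, ?_⟩
    rw [← Matrix.linSubstEntries_linSubstEntries, h2, Matrix.linSubstEntries_mul,
      Matrix.linSubstEntries_mul, Matrix.linSubstEntries_map_C, Matrix.linSubstEntries_map_C, h1,
      _root_.mul_inv_rev, Units.val_mul, Units.val_mul, Matrix.map_mul, Matrix.map_mul]
    simp only [Matrix.mul_assoc]
  | inv x _ hx =>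
    obtain ⟨g, h, h1⟩ := hx
    refine ⟨g⁻¹, h⁻¹, ?_⟩
    have key : A = (g : Matrix (Fin m) (Fin m) k).map C * Matrix.linSubstEntries x⁻¹ A *
        ((h⁻¹ : GL (Fin m) k) : Matrix (Fin m) (Fin m) k).map C := by
      have := congrArg (Matrix.linSubstEntries x⁻¹) h1
      rwa [Matrix.linSubstEntries_inv_linSubstEntries, Matrix.linSubstEntries_mul,
        Matrix.linSubstEntries_mul, Matrix.linSubstEntries_map_C, Matrix.linSubstEntries_map_C] at this
    rw [inv_inv]
    have hGL : ∀ u : GL (Fin m) k, ((u⁻¹ : GL (Fin m) k) : Matrix (Fin m) (Fin m) k).map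
        (C : k →+* MvPolynomial σ k) * (u : Matrix (Fin m) (Fin m) k).map (C : k →+* MvPolynomial σ k) = 1 :=
      fun u => by rw [← Matrix.map_mul, ← Units.val_mul, inv_mul_cancel, Units.val_one, Matrix.map_one C C_0 C_1]
    have hg := hGL g
    have hh := hGL h
    calc Matrix.linSubstEntries x⁻¹ A
        = (((g⁻¹ : GL (Fin m) k) : Matrix (Fin m) (Fin m) k).map C * (g : Matrix (Fin m) (Fin m) k).map C) *
            Matrix.linSubstEntries x⁻¹ A * (((h⁻¹ : GL (Fin m) k) : Matrix (Fin m) (Fin m) k).map C *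
              (h : Matrix (Fin m) (Fin m) k).map C) := by rw [hg, hh, Matrix.one_mul, Matrix.mul_one]
      _ = ((g⁻¹ : GL (Fin m) k) : Matrix (Fin m) (Fin m) k).map C * ((g : Matrix (Fin m) (Fin m) k).map C *
            Matrix.linSubstEntries x⁻¹ A * ((h⁻¹ : GL (Fin m) k) : Matrix (Fin m) (Fin m) k).map C) *
            (h : Matrix (Fin m) (Fin m) k).map C := by simp only [Matrix.mul_assoc]
      _ = ((g⁻¹ : GL (Fin m) k) : Matrix (Fin m) (Fin m) k).map C * A * (h : Matrix (Fin m) (Fin m) k).map C := by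
          rw [← key]

end Generators

/-! ### Grenet's matrix as a named object -/
namespace Grenet

variable (k : Type*) [CommRing k] (n : ℕ)

/-- The weights of Grenet's branching program: the arc leaving a set of cardinality `c` by
inserting `j` carries the variable `X (j, c)` (junk `0` for `c ≥ n`, never used).
[cite: Grenet2011, Thm. 1] -/
def wt (j : Fin n) (c : ℕ) : MvPolynomial (Fin n × Fin n) k :=
  if h : c < n then X (j, ⟨c, h⟩) else 0

/-- The weighted adjacency matrix of Grenet's branching program on the subsets of `Fin n`: an arc
`S → insert j S` of weight `X (j, |S|)` for every `j ∉ S`. [cite: Grenet2011, Thm. 1] -/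
def adj : Matrix (Finset (Fin n)) (Finset (Fin n)) (MvPolynomial (Fin n × Fin n) k) :=
  Matrix.of fun S T => ∑ j, if j ∉ S ∧ T = insert j S then wt k n j S.card else 0

/-- Entries of `adj`. [cite: Grenet2011, Thm. 1] -/
theorem adj_apply (S T : Finset (Fin n)) :
    adj k n S T = ∑ j, if j ∉ S ∧ T = insert j S then wt k n j S.card else 0 := rfl

/-- **Grenet's affine matrix** of size `N = 2ⁿ - 1`: the minor of `1 - adj` deleting the row of
`univ` and the column of `∅`, reindexed along `e : Finset (Fin n) ≃ Fin (N + 1)`, times the sign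
`(-1)^(e univ + e ∅)`. [cite: Grenet2011, Thm. 1] -/
def repr {N : ℕ} (e : Finset (Fin n) ≃ Fin (N + 1)) :
    Matrix (Fin N) (Fin N) (MvPolynomial (Fin n × Fin n) k) :=
  (-1 : MvPolynomial (Fin n × Fin n) k) ^ ((e univ : ℕ) + (e ∅ : ℕ)) •
    (((1 - adj k n).submatrix e.symm e.symm).submatrix (e univ).succAbove (e ∅).succAbove)

/-- **Grenet's matrix is an affine determinantal representation of `PER_n`** (`2ⁿ = N + 1`): its
entries are `0`, `±1`, `± X (j, c)` and its determinant is the permanent (Grenet 2011, Thm. 1;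
this is the proof of `determinantalComplexity_perPoly_le_holds` with the matrix named).
[cite: Grenet2011, Thm. 1] -/
theorem isAffineDetRepr_repr [Nontrivial k] (hn : n ≠ 0) {N : ℕ} (hN : 2 ^ n = N + 1)
    (e : Finset (Fin n) ≃ Fin (N + 1)) :
    IsAffineDetRepr (perPoly (Fin n) k) (repr k n e) := by
  have hwX : ∀ (j : Fin n) (c : Fin n), wt k n j c = X (j, c) := fun j c => by simp [wt]
  have hwdeg : ∀ j c, (wt k n j c).totalDegree ≤ 1 := fun j c => by
    unfold wt
    split_ifs
    · exact (totalDegree_X _).le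
    · simp
  have hA : ∀ S T, adj k n S T = ∑ j, if j ∉ S ∧ T = insert j S then wt k n j S.card else 0 :=
    fun _ _ => rfl
  have hdeg : ∀ S T, ((1 - adj k n) S T).totalDegree ≤ 1 := by
    intro S T
    rw [Matrix.sub_apply]
    refine (totalDegree_sub _ _).trans (max_le ?_ ?_)
    · rw [Matrix.one_apply]
      split_ifs <;> simp
    · rw [hA]
      refine totalDegree_finsetSum_le fun j _ => ?_
      split_ifs
      · exact hwdeg _ _
      · simp
  have hadj : ((1 - adj k n).submatrix e.symm e.symm).adjugate (e ∅) (e univ) = perPoly (Fin n) k := by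
    rw [Matrix.adjugate_submatrix_equiv_self, Matrix.submatrix_apply, e.symm_apply_apply,
      e.symm_apply_apply, Grenet.adjugate_one_sub_empty_univ (wt k n) hA, Grenet.sum_ite_injective,
      perPoly, Matrix.permanent]
    refine sum_congr rfl fun σ _ => prod_congr rfl fun t _ => ?_
    rw [hwX, Matrix.mvPolynomialX_apply]
  rw [Matrix.adjugate_fin_succ_eq_det_submatrix] at hadj
  have hodd : Odd N := by
    have h2 : Even (N + 1) := hN ▸ Nat.even_pow.mpr ⟨even_two, hn⟩
    exact Nat.not_even_iff_odd.mp (Nat.even_add_one.mp h2)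
  refine ⟨?_, ?_⟩
  · intro p q
    rw [repr, Matrix.smul_apply, smul_eq_mul]
    refine (totalDegree_mul _ _).trans ?_
    have h1 : ((-1 : MvPolynomial (Fin n × Fin n) k) ^ ((e univ : ℕ) + (e ∅ : ℕ))).totalDegree
        = 0 := by
      refine Nat.eq_zero_of_le_zero ((totalDegree_pow _ _).trans ?_)
      rw [totalDegree_neg, totalDegree_one, mul_zero]
    rw [h1, zero_add]
    exact hdeg _ _
  · rw [repr, Matrix.det_smul, Fintype.card_fin, ← pow_mul, pow_mul', hodd.neg_one_pow]
    exact hadj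

end Grenet

namespace Grenet

/-! ### The two-sided torus acts on Grenet's matrix by diagonal conjugation -/

section Torus

variable {k : Type*} [Field k] {n : ℕ}

/-- A diagonal substitution scales each variable. [folklore] -/
theorem linSubst_diagonal_X {σ : Type*} [Fintype σ] [DecidableEq σ] (v : σ → k) (i : σ) :
    linSubst σ k (Matrix.diagonal v) (X i) = v i • X i := by
  rw [linSubst_X]
  rw [Finset.sum_eq_single i (fun j _ hji => by rw [Matrix.diagonal_apply_ne _ hji, zero_smul])
    (fun h => absurd (mem_univ i) h), Matrix.diagonal_apply_eq]

/-- If `j ∉ S ⊆ Fin n` then `|S| < n`. [folklore] -/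
theorem card_lt_of_notMem {S : Finset (Fin n)} {j : Fin n} (hj : j ∉ S) : S.card < n := by
  have h1 : S.card < (insert j S).card := by rw [card_insert_of_notMem hj]; exact Nat.lt_succ_self _
  have h2 : (insert j S).card ≤ n := by simpa using Finset.card_le_univ (insert j S)
  omega

/-- The vertex scaling of Grenet's branching program induced by the torus element
`X (p, q) ↦ d p * e q * X (p, q)`: `Λ(S) = ∏_{j ∈ S} d j * ∏_{c < |S|} e c`.
[cite: LandsbergRessayre2017, §2.2] -/
def vscale (d e : Fin n → k) (S : Finset (Fin n)) : k :=
  (∏ j ∈ S, d j) * ∏ c ∈ univ.filter (fun c : Fin n => (c : ℕ) < S.card), e c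

/-- The vertex scalings are nonzero. [folklore] -/
theorem vscale_ne_zero {d e : Fin n → k} (hd : ∀ j, d j ≠ 0) (he : ∀ c, e c ≠ 0)
    (S : Finset (Fin n)) : vscale d e S ≠ 0 :=
  mul_ne_zero (prod_ne_zero_iff.mpr fun j _ => hd j) (prod_ne_zero_iff.mpr fun c _ => he c)

/-- Along an arc `S → insert j S` the vertex scaling grows by the arc's character `d j * e |S|`.
[cite: LandsbergRessayre2017, §2.2] -/
theorem vscale_insert (d e : Fin n → k) {S : Finset (Fin n)} {j : Fin n} (hj : j ∉ S) :
    vscale d e (insert j S) = vscale d e S * (d j * e ⟨S.card, card_lt_of_notMem hj⟩) := by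
  unfold vscale
  rw [prod_insert hj, card_insert_of_notMem hj]
  have hfilt : univ.filter (fun c : Fin n => (c : ℕ) < S.card + 1) =
      insert ⟨S.card, card_lt_of_notMem hj⟩ (univ.filter fun c : Fin n => (c : ℕ) < S.card) := by
    ext c
    simp only [mem_filter, mem_univ, true_and, mem_insert, Fin.ext_iff]
    omega
  have hnot : (⟨S.card, card_lt_of_notMem hj⟩ : Fin n) ∉ univ.filter fun c : Fin n => (c : ℕ) < S.card := by simp
  rw [hfilt, prod_insert hnot]
  ring

/-- The torus substitution scales a weight `X (j, c)` by `d j * e c`. [folklore] -/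
theorem linSubst_torus_wt (d e : Fin n → k) (j : Fin n) {c : ℕ} (hc : c < n) :
    linSubst (Fin n × Fin n) k (Matrix.diagonal fun p : Fin n × Fin n => d p.1 * e p.2) (wt k n j c) =
      (d j * e ⟨c, hc⟩) • wt k n j c := by
  simp only [wt, hc, ↓reduceDIte, linSubst_diagonal_X]

/-- **The torus acts on the adjacency matrix by the vertex scalings**:
`adj(γ · x) S T = Λ(S)⁻¹ Λ(T) · adj S T`. [cite: LandsbergRessayre2017, §2.2] -/
theorem linSubst_torus_adj {d e : Fin n → k} (hd : ∀ j, d j ≠ 0) (he : ∀ c, e c ≠ 0)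
    (S T : Finset (Fin n)) :
    linSubst (Fin n × Fin n) k (Matrix.diagonal fun p : Fin n × Fin n => d p.1 * e p.2) (adj k n S T) =
      C ((vscale d e S)⁻¹ * vscale d e T) * adj k n S T := by
  rw [adj_apply, map_sum, Finset.mul_sum]
  refine sum_congr rfl fun j _ => ?_
  by_cases h : j ∉ S ∧ T = insert j S
  · rw [if_pos h]
    obtain ⟨hj, rfl⟩ := h
    rw [linSubst_torus_wt d e j (card_lt_of_notMem hj), vscale_insert d e hj,
      MvPolynomial.smul_eq_C_mul, inv_mul_cancel_left₀ (vscale_ne_zero hd he S)]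
  · rw [if_neg h, map_zero, mul_zero]

/-- Matrix form: `(1 - adj)(γ · x) = Λ⁻¹ · (1 - adj) · Λ` with `Λ = diagonal (C ∘ vscale)`.
[cite: LandsbergRessayre2017, §2.2] -/
theorem map_linSubst_torus_one_sub_adj {d e : Fin n → k} (hd : ∀ j, d j ≠ 0) (he : ∀ c, e c ≠ 0) :
    (1 - adj k n).map (linSubst (Fin n × Fin n) k (Matrix.diagonal fun p : Fin n × Fin n => d p.1 * e p.2)) =
      Matrix.diagonal (fun S => C (vscale d e S)⁻¹) * (1 - adj k n) *
        Matrix.diagonal (fun T => C (vscale d e T)) := by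
  refine Matrix.ext fun S T => ?_
  rw [Matrix.map_apply, Matrix.sub_apply, map_sub, linSubst_torus_adj hd he, Matrix.mul_diagonal,
    Matrix.diagonal_mul, Matrix.sub_apply, Matrix.one_apply, map_mul]
  by_cases hST : S = T
  · subst hST
    have h1 : (C (vscale d e S)⁻¹ : MvPolynomial (Fin n × Fin n) k) * C (vscale d e S) = 1 := by
      rw [← map_mul, inv_mul_cancel₀ (vscale_ne_zero hd he S), map_one]
    rw [if_pos rfl, map_one]
    linear_combination -h1
  · rw [if_neg hST, map_zero]
    ring

end Torus

/-! ### Exact lifts and the equivariance theorem -/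

section Equivariance

variable {k : Type*} [Field k] {n : ℕ}

/-- An invertible diagonal matrix as an element of `GL`, with its inverse the entrywise inverse.
[folklore] -/
def diagUnit {ι : Type*} [Fintype ι] [DecidableEq ι] (a : ι → k) (ha : ∀ i, a i ≠ 0) : GL ι k :=
  ⟨Matrix.diagonal a, Matrix.diagonal fun i => (a i)⁻¹,
    by rw [Matrix.diagonal_mul_diagonal, ← Matrix.diagonal_one]
       exact congrArg Matrix.diagonal (funext fun i => mul_inv_cancel₀ (ha i)),
    by rw [Matrix.diagonal_mul_diagonal, ← Matrix.diagonal_one]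
       exact congrArg Matrix.diagonal (funext fun i => inv_mul_cancel₀ (ha i))⟩

/-- The matrix of `diagUnit`. [folklore] -/
@[simp] theorem val_diagUnit {ι : Type*} [Fintype ι] [DecidableEq ι] (a : ι → k) (ha : ∀ i, a i ≠ 0) :
    ((diagUnit a ha : GL ι k) : Matrix ι ι k) = Matrix.diagonal a := rfl
/-- The matrix of the inverse of `diagUnit`. [folklore] -/
@[simp] theorem val_inv_diagUnit {ι : Type*} [Fintype ι] [DecidableEq ι] (a : ι → k) (ha : ∀ i, a i ≠ 0) :
    ((diagUnit a ha)⁻¹ : GL ι k) = (Matrix.diagonal fun i => (a i)⁻¹ : Matrix ι ι k) := rfl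

/-- A submatrix of a two-sided diagonal scaling is a two-sided diagonal scaling of the submatrix.
[folklore] -/
theorem submatrix_diagonal_mul_mul_diagonal {R : Type*} [CommRing R] {ι ι' κ κ' : Type*}
    [Fintype ι] [DecidableEq ι] [Fintype κ] [DecidableEq κ] [Fintype ι'] [DecidableEq ι']
    [Fintype κ'] [DecidableEq κ']
    (a : ι → R) (b : κ → R) (M : Matrix ι κ R) (r : ι' → ι) (c : κ' → κ) :
    (Matrix.diagonal a * M * Matrix.diagonal b).submatrix r c =
      Matrix.diagonal (a ∘ r) * M.submatrix r c * Matrix.diagonal (b ∘ c) := by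
  refine Matrix.ext fun i j => ?_
  simp only [Matrix.submatrix_apply, Matrix.mul_diagonal, Matrix.diagonal_mul, Function.comp_apply]

/-- **The torus substitution on Grenet's matrix is a two-sided diagonal scaling**:
`M(γ · x) = Λ_rows⁻¹ · M(x) · Λ_cols` with `Λ` the vertex scalings of the surviving rows
(`≠ univ`) and columns (`≠ ∅`). [cite: LandsbergRessayre2017, §2.2] -/
theorem linSubstEntries_torus_repr {d e : Fin n → k} (hd : ∀ j, d j ≠ 0) (he : ∀ c, e c ≠ 0)
    {N : ℕ} (eqv : Finset (Fin n) ≃ Fin (N + 1)) (γ : GL (Fin n × Fin n) k)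
    (hγ : (γ : Matrix (Fin n × Fin n) (Fin n × Fin n) k) = Matrix.diagonal fun p => d p.1 * e p.2) :
    Matrix.linSubstEntries γ (repr k n eqv) =
      Matrix.diagonal (fun i => C (vscale d e (eqv.symm ((eqv univ).succAbove i)))⁻¹) * repr k n eqv *
        Matrix.diagonal (fun j => C (vscale d e (eqv.symm ((eqv ∅).succAbove j)))) := by
  unfold Matrix.linSubstEntries repr
  rw [hγ]
  set f := linSubst (Fin n × Fin n) k (Matrix.diagonal fun p : Fin n × Fin n => d p.1 * e p.2) with hf
  have hsign : f ((-1 : MvPolynomial (Fin n × Fin n) k) ^ ((eqv univ : ℕ) + (eqv ∅ : ℕ))) =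
      (-1 : MvPolynomial (Fin n × Fin n) k) ^ ((eqv univ : ℕ) + (eqv ∅ : ℕ)) := by
    rw [map_pow, map_neg, map_one]
  rw [Matrix.map_smul' _ _ _ (map_mul f), hsign, ← Matrix.submatrix_map, ← Matrix.submatrix_map, hf,
    map_linSubst_torus_one_sub_adj hd he,
    submatrix_diagonal_mul_mul_diagonal _ _ _ eqv.symm eqv.symm,
    submatrix_diagonal_mul_mul_diagonal _ _ _ (eqv univ).succAbove (eqv ∅).succAbove,
    Matrix.mul_smul, Matrix.smul_mul]
  rfl

/-- **Grenet's representation respects the two-sided torus, with exact lifts** (Landsberg–Ressayre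
2017, §2.2: Grenet's expressions respect the left torus; the right torus is respected by the same
vertex scalings): for the subgroup of `GL(n²)` generated by the substitutions
`X (p, q) ↦ d p * e q * X (p, q)`, every element lifts to diagonal `(g, h) ∈ GL_{2ⁿ-1} × GL_{2ⁿ-1}`
with `M(γ · x) = g · M(x) · h⁻¹`. [cite: LandsbergRessayre2017, §2.2] -/
theorem isEquivariantDetRepr_repr (hn : n ≠ 0) {N : ℕ} (hN : 2 ^ n = N + 1)
    (eqv : Finset (Fin n) ≃ Fin (N + 1)) :
    IsEquivariantDetRepr
      (Subgroup.closure {γ : GL (Fin n × Fin n) k | ∃ d e : Fin n → k,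
        (γ : Matrix (Fin n × Fin n) (Fin n × Fin n) k) = Matrix.diagonal (fun p => d p.1 * e p.2)})
      (perPoly (Fin n) k) (repr k n eqv) := by
  refine IsEquivariantDetRepr.of_generators (isAffineDetRepr_repr k n hn hN eqv) ?_
  rintro γ ⟨d, e, hγ⟩
  have hne : ∀ p : Fin n × Fin n, d p.1 * e p.2 ≠ 0 := by
    intro p
    have hdet : (γ : Matrix (Fin n × Fin n) (Fin n × Fin n) k).det ≠ 0 :=
      (Matrix.isUnits_det_units γ).ne_zero
    rw [hγ, Matrix.det_diagonal] at hdet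
    exact (prod_ne_zero_iff.mp hdet) p (mem_univ p)
  have hd : ∀ j, d j ≠ 0 := fun j => left_ne_zero_of_mul (hne (j, j))
  have he : ∀ c, e c ≠ 0 := fun c => right_ne_zero_of_mul (hne (c, c))
  refine ⟨diagUnit (fun i => (vscale d e (eqv.symm ((eqv univ).succAbove i)))⁻¹)
      (fun i => inv_ne_zero (vscale_ne_zero hd he _)),
    diagUnit (fun j => (vscale d e (eqv.symm ((eqv ∅).succAbove j)))⁻¹)
      (fun j => inv_ne_zero (vscale_ne_zero hd he _)), ?_⟩
  rw [linSubstEntries_torus_repr hd he eqv γ hγ, val_diagUnit, val_inv_diagUnit,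
    Matrix.diagonal_map (map_zero C), Matrix.diagonal_map (map_zero C)]
  simp only [inv_inv]

/-- **Hence `per_n` (`n ≥ 1`) has a two-sided-torus-equivariant affine determinantal representation
of size `2ⁿ - 1`** — the upper-bound half of `edc_T(per_n) = 2ⁿ - 1` for the two-sided torus `T`.
[cite: LandsbergRessayre2017, Thm. 2.8] -/
theorem hasEquivariantDetRepr_perPoly_twoSidedTorus (k : Type*) [Field k] {n : ℕ} (hn : n ≠ 0) :
    HasEquivariantDetRepr
      (Subgroup.closure {γ : GL (Fin n × Fin n) k | ∃ d e : Fin n → k,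
        (γ : Matrix (Fin n × Fin n) (Fin n × Fin n) k) = Matrix.diagonal (fun p => d p.1 * e p.2)})
      (perPoly (Fin n) k) (2 ^ n - 1) := by
  obtain ⟨N, hN⟩ : ∃ N, 2 ^ n = N + 1 := ⟨2 ^ n - 1, by have := @Nat.one_le_two_pow n; omega⟩
  rw [hN, Nat.add_sub_cancel]
  have hcard : Fintype.card (Finset (Fin n)) = N + 1 := by
    rw [Fintype.card_finset, Fintype.card_fin, hN]
  obtain ⟨eqv⟩ : Nonempty (Finset (Fin n) ≃ Fin (N + 1)) := ⟨Fintype.equivFinOfCardEq hcard⟩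
  exact ⟨repr k n eqv, isEquivariantDetRepr_repr hn hN eqv⟩

/-- In particular the two-sided-torus-equivariant determinantal complexity of `per_n` is at most
`2ⁿ - 1`. [cite: LandsbergRessayre2017, Thm. 2.8] -/
theorem equivariantDetComplexity_perPoly_twoSidedTorus_le (k : Type*) [Field k] {n : ℕ} (hn : n ≠ 0) :
    equivariantDetComplexity
      (Subgroup.closure {γ : GL (Fin n × Fin n) k | ∃ d e : Fin n → k,
        (γ : Matrix (Fin n × Fin n) (Fin n × Fin n) k) = Matrix.diagonal (fun p => d p.1 * e p.2)})
      (perPoly (Fin n) k) ≤ 2 ^ n - 1 :=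
  equivariantDetComplexity_le (hasEquivariantDetRepr_perPoly_twoSidedTorus k hn)

end Equivariance

end Grenet
end Literature.Computability.AlgebraicComplexity
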